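import Summits.AtomisticToContinuum.Crystallization.Theses.HullExactificationCascade
import Summits.AtomisticToContinuum.Crystallization.Theorems.HullExactificationCascadeHcpLandscapeGapStubBoxMinimiser
import Summits.AtomisticToContinuum.Crystallization.Theorems.HullExactificationCascadeHcpLandscapeGapStubBoundaryLayer
import Literature.MathematicalPhysics.StatisticalMechanics.BarlowStackingHeights

/-!
# Crux B `HcpLandscapeGap` (stmt-AtomisticToContinuum-12087) — alternative line `calibration`
# (strategist s1, 2026-08-17; registered with `--alt`, never replaces `Lines/birth.lean`)

**Idea (discrete null-Lagrangian / calibration).**  The registered line reduces B to templated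
coercivity T and lifts T from exact multilattices (T_exact, T_relaxed, T_slip: landed or in progress) to
all admissible `S`; the lift stalls on LOCALISATION (lead's L2: a window of a merely templated `S` is not
a union of complete exact columns; the fibre argument loses O(1) per fibre end, so windows cannot be
subdivided) and on in-plane/shear relaxation (L1) and plastic sites (L3).  This line makes the inequality
POINTWISE: a bounded antisymmetric pair flux `g` (a discrete null Lagrangian in the sense of
Friesecke–Theil 2002 / Conti–Dolzmann–Kirchheim–Müller 2006, an atomistic stress in the sense of
Ortner–Theil 2012 §1) is added to the infinite-volume site energy so that
`siteE(y) + (div g)(y) ≥ 2e⋆ + κ·1[y is η-bad]` holds AT EVERY SITE of an admissible `S`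
(`stub_calibratedSiteInequality_of_barlow`, on top of its zeroth order on exact relaxed multilattices
`stub_calibratedBarlowPricing`); summed over a window the flux telescopes to a boundary term
`≤ C(L+1)²` (`stub_fluxThroughBalls`, potential-free), which is exactly B.  Pointwise statements live in
the site's own frame: no window geometry, no rotation drift, free subdivision, additive contamination.
A flux is NECESSARY: breathing one hcp first shell outward by 3% (1/20-good) lowers that site's energy by
≈ 0.04 below `2e⋆` (STRATEGY-CENSUS.md §Negation), so `g = 0` is refuted; at linear order `g` is the
strain-gradient (half-space stress) flux, at quadratic order a local slack certificate of the hcp Hessian.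

Composition `HcpLandscapeGap_of : stub_fluxThroughBalls → stub_calibratedBarlowPricing →
stub_calibratedSiteInequality_of_barlow → HcpLandscapeGap` is proved below (window = finite sum, split by
the η-badness predicate, flux bounded below by `−C(L+1)²`), with the box minimiser from the landed
`stub_boxMinimiser` (p146639).
-/

open scoped BigOperators

namespace Summit.AtomisticToContinuum.Crystallization.Cruxes.HcpLandscapeGap.Calibration

/-- **Stub F (flux through balls; potential-free, M).** For a `δ`-separated `S ⊆ ℝ³` and ANY
antisymmetric pair flux `g` dominated by `G·r⁻⁶`, the window sum of the divergence
`Σ_{y ∈ S ∩ B̄_L(c)} Σ'_{z ∈ S, z ≠ y} g(y,z)` is a pure boundary term: the internal pairs cancel by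
antisymmetry and the crossing pairs are bounded by the `r⁻⁶` shell sums at depth `d`
(`Σ_d (L+1)² d⁻³`), i.e. `≤ C(L+1)²` (and `≥ −C(L+1)²` by `g ↦ −g`).  Why it might fail: only bookkeeping (summability of the
`r⁻⁶` majorant on a separated set, `sum_depth_le`). -/
theorem stub_fluxThroughBalls : ∀ δ : ℝ, 0 < δ → ∀ G : ℝ, 0 ≤ G → ∃ C : ℝ, ∀ S : Set (EuclideanSpace ℝ (Fin 3)), (∀ y ∈ S, ∀ z ∈ S, y ≠ z → δ ≤ dist y z) → ∀ g : EuclideanSpace ℝ (Fin 3) → EuclideanSpace ℝ (Fin 3) → ℝ, (∀ y z : EuclideanSpace ℝ (Fin 3), g y z = -g z y) → (∀ y z : EuclideanSpace ℝ (Fin 3), |g y z| ≤ G * (dist y z)⁻¹ ^ 6) → ∀ (c : EuclideanSpace ℝ (Fin 3)) (L : ℝ), 0 ≤ L → (∑' y : ↥{y : EuclideanSpace ℝ (Fin 3) | y ∈ S ∧ dist y c ≤ L}, (∑' z : ↥{z : EuclideanSpace ℝ (Fin 3) | z ∈ S ∧ z ≠ (y : EuclideanSpace ℝ (Fin 3))},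 g (y : EuclideanSpace ℝ (Fin 3)) (z : EuclideanSpace ℝ (Fin 3)))) ≤ C * (L + 1) ^ 2 := by
  sorry

/-- **Stub Z (calibrated Barlow pricing; zeroth order, M–L).** POINTWISE version of the landed window
inequality T_relaxed (`stub_relaxedBarlowPricing`, p167995): on every rigid image of an exact relaxed
Barlow multilattice `barlowStackingH a' H s` (any Hägg word, in-layer scale `a' ∈ [47/50,1]`, spacing
profile in the band) there is an antisymmetric `G·r⁻⁶`-dominated flux `g` (expected: range-1 transfer
along the stacking direction making Jensen-in-the-spacing-profile and the registry majorisation local)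
such that `siteE(y) + div g(y) ≥ 2e⋆` at every site and `≥ 2e⋆ + κ` at every site whose unscaled
`13a/10`-shell is not `η`-congruent to the `hcp(a,h)` shell.  Why it might fail: the fault penalty `J₂`
sits on the layers ADJACENT to a cubic layer, and the spacing convexity gain is a column (not site)
quantity — both need an explicit bounded transfer; a layer whose energy dips below `e⋆` by more than its
neighbours' surplus within bounded range would refute it (cheapest falsifier: exact layer energies of all
Hägg words of period ≤ 12 at the box minimiser, in-Lean via the landed `E1`/`PW` tables). -/
theorem stub_calibratedBarlowPricing : ∀ (a h : ℝ) (ha : a ≠ 0) (hh : h ≠ 0), (9 / 10 < a ∧ a < 1 ∧ |h - a * Real.sqrt (2 / 3)| ≤ a / 100) → (∀ a' h' : ℝ, ∀ ha' : a' ≠ 0, ∀ hh' : h' ≠ 0, (9 / 10 < a' ∧ a' < 1 ∧ |h' - a' * Real.sqrt (2 / 3)| ≤ a' / 100) → (Literature.MathematicalPhysics.StatisticalMechanics.hcpPeriodicConfiguration ha hh).energyPerParticle Literature.MathematicalPhysics.StatisticalMechanics.lennardJones ≤ (Literature.MathematicalPhysics.StatisticalMechanics.hcpPeriodicConfiguration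 ha' hh').energyPerParticle Literature.MathematicalPhysics.StatisticalMechanics.lennardJones) → ∀ η : ℝ, 0 < η → ∃ κ : ℝ, 0 < κ ∧ ∃ G : ℝ, 0 ≤ G ∧ ∀ (a' : ℝ), 47 / 50 ≤ a' → a' ≤ 1 → ∀ s : ℤ → ℤ, Literature.MathematicalPhysics.StatisticalMechanics.IsHaggSeq s → ∀ H : ℤ → ℝ, (∀ k : ℤ, 39 / 50 * a' ≤ H (k + 1) - H k ∧ H (k + 1) - H k ≤ 17 / 20 * a') → ∀ (B : EuclideanSpace ℝ (Fin 3) →ₗᵢ[ℝ] EuclideanSpace ℝ (Fin 3)) (v : EuclideanSpace ℝ (Fin 3)) (S : Set (EuclideanSpace ℝ (Fin 3))), S = (fun w => v + B w) '' Literature.MathematicalPhysics.StatisticalMechanics.barlowStackingH a' H s → ∃ g : EuclideanSpace ℝ (Fin 3) → EuclideanSpace ℝ (Fin 3) → ℝ, (∀ y z : EuclideanSpace ℝ (Fin 3), g y z = -g z y) ∧ (∀ y z : EuclideanSpace ℝ (Fin 3), |g y z| ≤ G * (dist y z)⁻¹ ^ 6) ∧ (∀ y ∈ S, 2 * ((Literature.MathematicalPhysics.StatisticalMechanics.hcpPeriodicConfiguration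 ha hh).energyPerParticle Literature.MathematicalPhysics.StatisticalMechanics.lennardJones) ≤ (∑' z : ↥{z : EuclideanSpace ℝ (Fin 3) | z ∈ S ∧ z ≠ y}, Literature.MathematicalPhysics.StatisticalMechanics.lennardJones (dist y (z : EuclideanSpace ℝ (Fin 3)))) + (∑' z : ↥{z : EuclideanSpace ℝ (Fin 3) | z ∈ S ∧ z ≠ y}, g y (z : EuclideanSpace ℝ (Fin 3)))) ∧ (∀ y ∈ S, ¬ (let T : Set (EuclideanSpace ℝ (Fin 3)) := {z : EuclideanSpace ℝ (Fin 3) | z ∈ S ∧ z ≠ y ∧ dist z y < 13 / 10 * a}; let P : Set (EuclideanSpace ℝ (Fin 3)) := {p : EuclideanSpace ℝ (Fin 3) | p ∈ Literature.MathematicalPhysics.StatisticalMechanics.hcpStacking a h ∧ p ≠ 0 ∧ ‖p‖ < 13 / 10 * a}; ∃ A : EuclideanSpace ℝ (Fin 3) →ₗᵢ[ℝ] EuclideanSpace ℝ (Fin 3), ∃ e : ↥T ≃ ↥P, ∀ t : ↥T, dist ((t : EuclideanSpace ℝ (Fin 3)) - y) (A ((e t : ↥P) : EuclideanSpace ℝ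 (Fin 3))) ≤ η) → 2 * ((Literature.MathematicalPhysics.StatisticalMechanics.hcpPeriodicConfiguration ha hh).energyPerParticle Literature.MathematicalPhysics.StatisticalMechanics.lennardJones) + κ ≤ (∑' z : ↥{z : EuclideanSpace ℝ (Fin 3) | z ∈ S ∧ z ≠ y}, Literature.MathematicalPhysics.StatisticalMechanics.lennardJones (dist y (z : EuclideanSpace ℝ (Fin 3)))) + (∑' z : ↥{z : EuclideanSpace ℝ (Fin 3) | z ∈ S ∧ z ≠ y}, g y (z : EuclideanSpace ℝ (Fin 3)))) := by
  sorry

/-- **Stub ZA (calibrated site inequality from its zeroth order; the transfer C⁺, XL).** Given Stub Z,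
for every admissible `S` of crux B (δ-separated, everywhere 1/20-good, Barlow-templated) there is an
antisymmetric `G·r⁻⁶`-dominated pair flux `g` with `siteE(y) + div g(y) ≥ 2e⋆ + κ·1[y η-bad]` at EVERY
site.  Expected proof: Conti–Dolzmann–Kirchheim–Müller / Friesecke–Theil discrete null Lagrangian around
each registry well of the local Barlow cell (cells read off the template), E–Ming / Ortner–Theil treatment
of the `r⁻⁶` tail (far-field first-order terms are the half-space tail stress, transported along template
segments), quadratic order from a local slack (SOS) certificate of the LJ hcp/fcc Hessians, cubic remainder
pointwise; Stub Z prices the bottoms of the wells.  Why it might fail: the perturbative radius of the cell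
inequality may not reach the goodness tolerance 1/20 (intermediate 1%–5% distortions need a certified
non-perturbative cell bound), and far-field first-order charges are O(strain) at the receiving site. -/
theorem stub_calibratedSiteInequality_of_barlow : (∀ (a h : ℝ) (ha : a ≠ 0) (hh : h ≠ 0), (9 / 10 < a ∧ a < 1 ∧ |h - a * Real.sqrt (2 / 3)| ≤ a / 100) → (∀ a' h' : ℝ, ∀ ha' : a' ≠ 0, ∀ hh' : h' ≠ 0, (9 / 10 < a' ∧ a' < 1 ∧ |h' - a' * Real.sqrt (2 / 3)| ≤ a' / 100) → (Literature.MathematicalPhysics.StatisticalMechanics.hcpPeriodicConfiguration ha hh).energyPerParticle Literature.MathematicalPhysics.StatisticalMechanics.lennardJones ≤ (Literature.MathematicalPhysics.StatisticalMechanics.hcpPeriodicConfiguration ha' hh').energyPerParticle Literature.MathematicalPhysics.StatisticalMechanics.lennardJones) → ∀ η : ℝ, 0 < η → ∃ κ : ℝ, 0 < κ ∧ ∃ G : ℝ, 0 ≤ G ∧ ∀ (a' : ℝ), 47 / 50 ≤ a' → a' ≤ 1 → ∀ s : ℤ → ℤ, Literature.MathematicalPhysics.StatisticalMechanics.IsHaggSeq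 s → ∀ H : ℤ → ℝ, (∀ k : ℤ, 39 / 50 * a' ≤ H (k + 1) - H k ∧ H (k + 1) - H k ≤ 17 / 20 * a') → ∀ (B : EuclideanSpace ℝ (Fin 3) →ₗᵢ[ℝ] EuclideanSpace ℝ (Fin 3)) (v : EuclideanSpace ℝ (Fin 3)) (S : Set (EuclideanSpace ℝ (Fin 3))), S = (fun w => v + B w) '' Literature.MathematicalPhysics.StatisticalMechanics.barlowStackingH a' H s → ∃ g : EuclideanSpace ℝ (Fin 3) → EuclideanSpace ℝ (Fin 3) → ℝ, (∀ y z : EuclideanSpace ℝ (Fin 3), g y z = -g z y) ∧ (∀ y z : EuclideanSpace ℝ (Fin 3), |g y z| ≤ G * (dist y z)⁻¹ ^ 6) ∧ (∀ y ∈ S, 2 * ((Literature.MathematicalPhysics.StatisticalMechanics.hcpPeriodicConfiguration ha hh).energyPerParticle Literature.MathematicalPhysics.StatisticalMechanics.lennardJones) ≤ (∑' z : ↥{z : EuclideanSpace ℝ (Fin 3) | z ∈ S ∧ z ≠ y}, Literature.MathematicalPhysics.StatisticalMechanics.lennardJones (dist y (z : EuclideanSpace ℝ (Fin 3)))) + (∑'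 z : ↥{z : EuclideanSpace ℝ (Fin 3) | z ∈ S ∧ z ≠ y}, g y (z : EuclideanSpace ℝ (Fin 3)))) ∧ (∀ y ∈ S, ¬ (let T : Set (EuclideanSpace ℝ (Fin 3)) := {z : EuclideanSpace ℝ (Fin 3) | z ∈ S ∧ z ≠ y ∧ dist z y < 13 / 10 * a}; let P : Set (EuclideanSpace ℝ (Fin 3)) := {p : EuclideanSpace ℝ (Fin 3) | p ∈ Literature.MathematicalPhysics.StatisticalMechanics.hcpStacking a h ∧ p ≠ 0 ∧ ‖p‖ < 13 / 10 * a}; ∃ A : EuclideanSpace ℝ (Fin 3) →ₗᵢ[ℝ] EuclideanSpace ℝ (Fin 3), ∃ e : ↥T ≃ ↥P, ∀ t : ↥T, dist ((t : EuclideanSpace ℝ (Fin 3)) - y) (A ((e t : ↥P) : EuclideanSpace ℝ (Fin 3))) ≤ η) → 2 * ((Literature.MathematicalPhysics.StatisticalMechanics.hcpPeriodicConfiguration ha hh).energyPerParticle Literature.MathematicalPhysics.StatisticalMechanics.lennardJones) + κ ≤ (∑' z : ↥{z : EuclideanSpace ℝ (Fin 3) | z ∈ S ∧ z ≠ y}, Literature.MathematicalPhysics.StatisticalMechanics.lennardJones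 (dist y (z : EuclideanSpace ℝ (Fin 3)))) + (∑' z : ↥{z : EuclideanSpace ℝ (Fin 3) | z ∈ S ∧ z ≠ y}, g y (z : EuclideanSpace ℝ (Fin 3))))) → ∀ (a h : ℝ) (ha : a ≠ 0) (hh : h ≠ 0), (9 / 10 < a ∧ a < 1 ∧ |h - a * Real.sqrt (2 / 3)| ≤ a / 100) → (∀ a' h' : ℝ, ∀ ha' : a' ≠ 0, ∀ hh' : h' ≠ 0, (9 / 10 < a' ∧ a' < 1 ∧ |h' - a' * Real.sqrt (2 / 3)| ≤ a' / 100) → (Literature.MathematicalPhysics.StatisticalMechanics.hcpPeriodicConfiguration ha hh).energyPerParticle Literature.MathematicalPhysics.StatisticalMechanics.lennardJones ≤ (Literature.MathematicalPhysics.StatisticalMechanics.hcpPeriodicConfiguration ha' hh').energyPerParticle Literature.MathematicalPhysics.StatisticalMechanics.lennardJones) → ∀ δ : ℝ, 0 < δ → ∀ η : ℝ, 0 < η → ∃ κ : ℝ, 0 < κ ∧ ∃ G : ℝ, 0 ≤ G ∧ ∀ S : Set (EuclideanSpace ℝ (Fin 3)), (∀ y ∈ S, ∀ z ∈ S, y ≠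 z → δ ≤ dist y z) → (∀ y ∈ S, (let d : ℝ := sInf ((fun z => dist z y) '' (S \ {y})); let T : Set (EuclideanSpace ℝ (Fin 3)) := {z : EuclideanSpace ℝ (Fin 3) | z ∈ S ∧ z ≠ y ∧ dist z y < 13 / 10 * d}; ∃ A : EuclideanSpace ℝ (Fin 3) →ₗᵢ[ℝ] EuclideanSpace ℝ (Fin 3), (∃ e : ↥T ≃ ↥Literature.Geometry.DiscreteGeometry.fccKissingPattern, ∀ t : ↥T, dist (d⁻¹ • ((t : EuclideanSpace ℝ (Fin 3)) - y)) (A ((e t : ↥Literature.Geometry.DiscreteGeometry.fccKissingPattern) : EuclideanSpace ℝ (Fin 3))) ≤ 1 / 20) ∨ (∃ e : ↥T ≃ ↥Literature.Geometry.DiscreteGeometry.hcpKissingPattern, ∀ t : ↥T, dist (d⁻¹ • ((t : EuclideanSpace ℝ (Fin 3)) - y)) (A ((e t : ↥Literature.Geometry.DiscreteGeometry.hcpKissingPattern) : EuclideanSpace ℝ (Fin 3))) ≤ 1 / 20))) → (∃ s : ℤ → ℤ, Literature.MathematicalPhysics.StatisticalMechanics.IsHaggSeq s ∧ ∃ Φ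 : EuclideanSpace ℝ (Fin 3) → EuclideanSpace ℝ (Fin 3), Set.BijOn Φ (Literature.MathematicalPhysics.StatisticalMechanics.barlowStacking 1 (Real.sqrt (2 / 3)) s) S ∧ ∀ p ∈ Literature.MathematicalPhysics.StatisticalMechanics.barlowStacking 1 (Real.sqrt (2 / 3)) s, ∃ A : EuclideanSpace ℝ (Fin 3) →ₗᵢ[ℝ] EuclideanSpace ℝ (Fin 3), ∃ l : ℝ, 0 < l ∧ ∀ q ∈ Literature.MathematicalPhysics.StatisticalMechanics.barlowStacking 1 (Real.sqrt (2 / 3)) s, dist q p ≤ 1 → dist (Φ q) (Φ p + l • A (q - p)) ≤ 1 / 20 * l) → ∃ g : EuclideanSpace ℝ (Fin 3) → EuclideanSpace ℝ (Fin 3) → ℝ, (∀ y z : EuclideanSpace ℝ (Fin 3), g y z = -g z y) ∧ (∀ y z : EuclideanSpace ℝ (Fin 3), |g y z| ≤ G * (dist y z)⁻¹ ^ 6) ∧ (∀ y ∈ S, 2 * ((Literature.MathematicalPhysics.StatisticalMechanics.hcpPeriodicConfiguration ha hh).energyPerParticle Literature.MathematicalPhysics.StatisticalMechanics.lennardJones)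 ≤ (∑' z : ↥{z : EuclideanSpace ℝ (Fin 3) | z ∈ S ∧ z ≠ y}, Literature.MathematicalPhysics.StatisticalMechanics.lennardJones (dist y (z : EuclideanSpace ℝ (Fin 3)))) + (∑' z : ↥{z : EuclideanSpace ℝ (Fin 3) | z ∈ S ∧ z ≠ y}, g y (z : EuclideanSpace ℝ (Fin 3)))) ∧ (∀ y ∈ S, ¬ (let T : Set (EuclideanSpace ℝ (Fin 3)) := {z : EuclideanSpace ℝ (Fin 3) | z ∈ S ∧ z ≠ y ∧ dist z y < 13 / 10 * a}; let P : Set (EuclideanSpace ℝ (Fin 3)) := {p : EuclideanSpace ℝ (Fin 3) | p ∈ Literature.MathematicalPhysics.StatisticalMechanics.hcpStacking a h ∧ p ≠ 0 ∧ ‖p‖ < 13 / 10 * a}; ∃ A : EuclideanSpace ℝ (Fin 3) →ₗᵢ[ℝ] EuclideanSpace ℝ (Fin 3), ∃ e : ↥T ≃ ↥P, ∀ t : ↥T, dist ((t : EuclideanSpace ℝ (Fin 3)) - y) (A ((e t : ↥P) : EuclideanSpace ℝ (Fin 3))) ≤ η) → 2 * ((Literature.MathematicalPhysics.StatisticalMechanics.hcpPeriodicConfiguration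 ha hh).energyPerParticle Literature.MathematicalPhysics.StatisticalMechanics.lennardJones) + κ ≤ (∑' z : ↥{z : EuclideanSpace ℝ (Fin 3) | z ∈ S ∧ z ≠ y}, Literature.MathematicalPhysics.StatisticalMechanics.lennardJones (dist y (z : EuclideanSpace ℝ (Fin 3)))) + (∑' z : ↥{z : EuclideanSpace ℝ (Fin 3) | z ∈ S ∧ z ≠ y}, g y (z : EuclideanSpace ℝ (Fin 3)))) := by
  sorry

/-! ## The composition (sorry-free) -/

/-- **Window bookkeeping (proved).** If every site of a `δ`-separated `S` satisfies
`e ≤ F y + Fl y`, the sites failing `P` satisfy `e + κ ≤ F y + Fl y` (`κ ≥ 0`), and the window sum of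
`Fl` over `S ∩ B̄_L(c)` is at most `C(L+1)²`, then
`e·#(S ∩ B̄_L(c)) + κ·#{y ∈ S ∩ B̄_L(c) : ¬P y} − C(L+1)² ≤ Σ_{y ∈ S ∩ B̄_L(c)} F y`
(the window is finite; split the finite sum by `P`). -/
theorem window_sum_of_pointwise {S : Set (EuclideanSpace ℝ (Fin 3))} {δ : ℝ} (hδ : 0 < δ)
    (hsep : ∀ y ∈ S, ∀ z ∈ S, y ≠ z → δ ≤ dist y z) (c : EuclideanSpace ℝ (Fin 3)) (L : ℝ)
    {P : EuclideanSpace ℝ (Fin 3) → Prop} {F Fl : EuclideanSpace ℝ (Fin 3) → ℝ} {e κ C : ℝ}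
    (hfloor : ∀ y ∈ S, e ≤ F y + Fl y) (hcoer : ∀ y ∈ S, ¬ P y → e + κ ≤ F y + Fl y)
    (hflux : (∑' y : ↥({y : EuclideanSpace ℝ (Fin 3) | y ∈ S ∧ dist y c ≤ L} :
      Set (EuclideanSpace ℝ (Fin 3))), Fl y) ≤ C * (L + 1) ^ 2) :
    e * (({y : EuclideanSpace ℝ (Fin 3) | y ∈ S ∧ dist y c ≤ L} :
          Set (EuclideanSpace ℝ (Fin 3))).ncard : ℝ) +
        κ * (({y : EuclideanSpace ℝ (Fin 3) | y ∈ S ∧ dist y c ≤ L ∧ ¬ P y} :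
          Set (EuclideanSpace ℝ (Fin 3))).ncard : ℝ) - C * (L + 1) ^ 2 ≤
      ∑' y : ↥({y : EuclideanSpace ℝ (Fin 3) | y ∈ S ∧ dist y c ≤ L} :
        Set (EuclideanSpace ℝ (Fin 3))), F y := by
  classical
  set W : Set (EuclideanSpace ℝ (Fin 3)) := {y | y ∈ S ∧ dist y c ≤ L} with hW
  have hWfin : W.Finite :=
    Literature.MathematicalPhysics.StatisticalMechanics.finite_of_forall_le_dist_of_subset_closedBall hδ
      (fun p hp q hq hpq => hsep p hp.1 q hq.1 hpq) (c := c) (R := L)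
      (fun p hp => Metric.mem_closedBall.2 hp.2)
  set Wf : Finset (EuclideanSpace ℝ (Fin 3)) := hWfin.toFinset with hWf
  have hmemWf : ∀ y, y ∈ Wf ↔ y ∈ S ∧ dist y c ≤ L := fun y => by
    rw [hWf, Set.Finite.mem_toFinset]
    rfl
  have htsumF : ∑' y : ↥W, F y = ∑ y ∈ Wf, F y := by
    rw [tsum_congr_set_coe F hWfin.coe_toFinset.symm]
    exact Finset.tsum_subtype _ F
  have htsumFl : ∑' y : ↥W, Fl y = ∑ y ∈ Wf, Fl y := by
    rw [tsum_congr_set_coe Fl hWfin.coe_toFinset.symm]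
    exact Finset.tsum_subtype _ Fl
  have hncardW : (W.ncard : ℝ) = Wf.card := by
    rw [Set.ncard_eq_toFinset_card W hWfin]
  have hBad : ({y : EuclideanSpace ℝ (Fin 3) | y ∈ S ∧ dist y c ≤ L ∧ ¬ P y} :
      Set (EuclideanSpace ℝ (Fin 3))) = ↑(Wf.filter fun y => ¬ P y) := by
    ext y
    rw [Finset.coe_filter, Set.mem_setOf_eq, Set.mem_setOf_eq, hmemWf, and_assoc]
  have hncardBad : (({y : EuclideanSpace ℝ (Fin 3) | y ∈ S ∧ dist y c ≤ L ∧ ¬ P y} :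
      Set (EuclideanSpace ℝ (Fin 3))).ncard : ℝ) = (Wf.filter fun y => ¬ P y).card := by
    rw [hBad, Set.ncard_coe_finset]
  have h1 : ((Wf.filter fun y => ¬ P y).card : ℝ) * (e + κ) ≤
      ∑ y ∈ Wf.filter (fun y => ¬ P y), (F y + Fl y) := by
    have h := Finset.card_nsmul_le_sum (Wf.filter fun y => ¬ P y) (fun y => F y + Fl y) (e + κ)
      (fun y hy => by
        rw [Finset.mem_filter] at hy
        exact hcoer y ((hmemWf y).1 hy.1).1 hy.2)
    rw [nsmul_eq_mul] at h
    exact h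
  have h2 : ((Wf.filter fun y => ¬¬ P y).card : ℝ) * e ≤
      ∑ y ∈ Wf.filter (fun y => ¬¬ P y), (F y + Fl y) := by
    have h := Finset.card_nsmul_le_sum (Wf.filter fun y => ¬¬ P y) (fun y => F y + Fl y) e
      (fun y hy => by
        rw [Finset.mem_filter] at hy
        exact hfloor y ((hmemWf y).1 hy.1).1)
    rw [nsmul_eq_mul] at h
    exact h
  have hsplit : ∑ y ∈ Wf.filter (fun y => ¬ P y), (F y + Fl y) +
      ∑ y ∈ Wf.filter (fun y => ¬¬ P y), (F y + Fl y) = ∑ y ∈ Wf, (F y + Fl y) :=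
    Finset.sum_filter_add_sum_filter_not Wf (fun y => ¬ P y) _
  have hcard : ((Wf.filter fun y => ¬ P y).card : ℝ) + ((Wf.filter fun y => ¬¬ P y).card : ℝ) =
      Wf.card := by
    exact_mod_cast Finset.card_filter_add_card_filter_not (s := Wf) (fun y => ¬ P y)
  have hsum : ∑ y ∈ Wf, (F y + Fl y) = ∑ y ∈ Wf, F y + ∑ y ∈ Wf, Fl y := Finset.sum_add_distrib
  rw [htsumFl] at hflux
  rw [htsumF, hncardW, hncardBad, ← hcard]
  nlinarith [h1, h2, hsplit, hsum, hflux]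

/-- **Composition (kernel-checked).** Stub F, Stub Z and Stub ZA imply crux B
`HullExactificationCascade.HcpLandscapeGap` (conclusion = the body of the route decl verbatim;
`HcpLandscapeGap_of_stubs` below states it BY NAME): the box minimiser is the landed
`stub_boxMinimiser`; for `δ, η` take `κ, G, g` from the calibrated site inequality and `C` from the flux
lemma; sum the pointwise inequality over the finite window (`window_sum_of_pointwise`). -/
theorem HcpLandscapeGap_of :
    (∀ δ : ℝ, 0 < δ → ∀ G : ℝ, 0 ≤ G → ∃ C : ℝ, ∀ S : Set (EuclideanSpace ℝ (Fin 3)), (∀ y ∈ S, ∀ z ∈ S, y ≠ z → δ ≤ dist y z) → ∀ g : EuclideanSpace ℝ (Fin 3) → EuclideanSpace ℝ (Fin 3) → ℝ, (∀ y z : EuclideanSpace ℝ (Fin 3), g y z = -g z y) → (∀ y z : EuclideanSpace ℝ (Fin 3), |g y z| ≤ G * (dist y z)⁻¹ ^ 6) → ∀ (c : EuclideanSpace ℝ (Fin 3)) (L : ℝ), 0 ≤ L → (∑' y : ↥{y : EuclideanSpace ℝ (Fin 3) | y ∈ S ∧ dist y c ≤ L}, (∑' z : ↥{z : EuclideanSpace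 ℝ (Fin 3) | z ∈ S ∧ z ≠ (y : EuclideanSpace ℝ (Fin 3))}, g (y : EuclideanSpace ℝ (Fin 3)) (z : EuclideanSpace ℝ (Fin 3)))) ≤ C * (L + 1) ^ 2) →
    (∀ (a h : ℝ) (ha : a ≠ 0) (hh : h ≠ 0), (9 / 10 < a ∧ a < 1 ∧ |h - a * Real.sqrt (2 / 3)| ≤ a / 100) → (∀ a' h' : ℝ, ∀ ha' : a' ≠ 0, ∀ hh' : h' ≠ 0, (9 / 10 < a' ∧ a' < 1 ∧ |h' - a' * Real.sqrt (2 / 3)| ≤ a' / 100) → (Literature.MathematicalPhysics.StatisticalMechanics.hcpPeriodicConfiguration ha hh).energyPerParticle Literature.MathematicalPhysics.StatisticalMechanics.lennardJones ≤ (Literature.MathematicalPhysics.StatisticalMechanics.hcpPeriodicConfiguration ha' hh').energyPerParticle Literature.MathematicalPhysics.StatisticalMechanics.lennardJones) → ∀ η : ℝ, 0 < η → ∃ κ : ℝ, 0 < κ ∧ ∃ G : ℝ, 0 ≤ G ∧ ∀ (a' : ℝ), 47 / 50 ≤ a' → a' ≤ 1 → ∀ s : ℤ → ℤ, Literature.MathematicalPhysics.StatisticalMechanics.IsHaggSeq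 s → ∀ H : ℤ → ℝ, (∀ k : ℤ, 39 / 50 * a' ≤ H (k + 1) - H k ∧ H (k + 1) - H k ≤ 17 / 20 * a') → ∀ (B : EuclideanSpace ℝ (Fin 3) →ₗᵢ[ℝ] EuclideanSpace ℝ (Fin 3)) (v : EuclideanSpace ℝ (Fin 3)) (S : Set (EuclideanSpace ℝ (Fin 3))), S = (fun w => v + B w) '' Literature.MathematicalPhysics.StatisticalMechanics.barlowStackingH a' H s → ∃ g : EuclideanSpace ℝ (Fin 3) → EuclideanSpace ℝ (Fin 3) → ℝ, (∀ y z : EuclideanSpace ℝ (Fin 3), g y z = -g z y) ∧ (∀ y z : EuclideanSpace ℝ (Fin 3), |g y z| ≤ G * (dist y z)⁻¹ ^ 6) ∧ (∀ y ∈ S, 2 * ((Literature.MathematicalPhysics.StatisticalMechanics.hcpPeriodicConfiguration ha hh).energyPerParticle Literature.MathematicalPhysics.StatisticalMechanics.lennardJones) ≤ (∑' z : ↥{z : EuclideanSpace ℝ (Fin 3) | z ∈ S ∧ z ≠ y}, Literature.MathematicalPhysics.StatisticalMechanics.lennardJones (dist y (z : EuclideanSpace ℝ (Fin 3)))) + (∑'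 z : ↥{z : EuclideanSpace ℝ (Fin 3) | z ∈ S ∧ z ≠ y}, g y (z : EuclideanSpace ℝ (Fin 3)))) ∧ (∀ y ∈ S, ¬ (let T : Set (EuclideanSpace ℝ (Fin 3)) := {z : EuclideanSpace ℝ (Fin 3) | z ∈ S ∧ z ≠ y ∧ dist z y < 13 / 10 * a}; let P : Set (EuclideanSpace ℝ (Fin 3)) := {p : EuclideanSpace ℝ (Fin 3) | p ∈ Literature.MathematicalPhysics.StatisticalMechanics.hcpStacking a h ∧ p ≠ 0 ∧ ‖p‖ < 13 / 10 * a}; ∃ A : EuclideanSpace ℝ (Fin 3) →ₗᵢ[ℝ] EuclideanSpace ℝ (Fin 3), ∃ e : ↥T ≃ ↥P, ∀ t : ↥T, dist ((t : EuclideanSpace ℝ (Fin 3)) - y) (A ((e t : ↥P) : EuclideanSpace ℝ (Fin 3))) ≤ η) → 2 * ((Literature.MathematicalPhysics.StatisticalMechanics.hcpPeriodicConfiguration ha hh).energyPerParticle Literature.MathematicalPhysics.StatisticalMechanics.lennardJones) + κ ≤ (∑' z : ↥{z : EuclideanSpace ℝ (Fin 3) | z ∈ S ∧ z ≠ y}, Literature.MathematicalPhysics.StatisticalMechanics.lennardJones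 (dist y (z : EuclideanSpace ℝ (Fin 3)))) + (∑' z : ↥{z : EuclideanSpace ℝ (Fin 3) | z ∈ S ∧ z ≠ y}, g y (z : EuclideanSpace ℝ (Fin 3))))) →
    ((∀ (a h : ℝ) (ha : a ≠ 0) (hh : h ≠ 0), (9 / 10 < a ∧ a < 1 ∧ |h - a * Real.sqrt (2 / 3)| ≤ a / 100) → (∀ a' h' : ℝ, ∀ ha' : a' ≠ 0, ∀ hh' : h' ≠ 0, (9 / 10 < a' ∧ a' < 1 ∧ |h' - a' * Real.sqrt (2 / 3)| ≤ a' / 100) → (Literature.MathematicalPhysics.StatisticalMechanics.hcpPeriodicConfiguration ha hh).energyPerParticle Literature.MathematicalPhysics.StatisticalMechanics.lennardJones ≤ (Literature.MathematicalPhysics.StatisticalMechanics.hcpPeriodicConfiguration ha' hh').energyPerParticle Literature.MathematicalPhysics.StatisticalMechanics.lennardJones) → ∀ η : ℝ, 0 < η → ∃ κ : ℝ, 0 < κ ∧ ∃ G : ℝ, 0 ≤ G ∧ ∀ (a' : ℝ), 47 / 50 ≤ a' → a' ≤ 1 → ∀ s : ℤ → ℤ, Literature.MathematicalPhysics.StatisticalMechanics.IsHaggSeq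 s → ∀ H : ℤ → ℝ, (∀ k : ℤ, 39 / 50 * a' ≤ H (k + 1) - H k ∧ H (k + 1) - H k ≤ 17 / 20 * a') → ∀ (B : EuclideanSpace ℝ (Fin 3) →ₗᵢ[ℝ] EuclideanSpace ℝ (Fin 3)) (v : EuclideanSpace ℝ (Fin 3)) (S : Set (EuclideanSpace ℝ (Fin 3))), S = (fun w => v + B w) '' Literature.MathematicalPhysics.StatisticalMechanics.barlowStackingH a' H s → ∃ g : EuclideanSpace ℝ (Fin 3) → EuclideanSpace ℝ (Fin 3) → ℝ, (∀ y z : EuclideanSpace ℝ (Fin 3), g y z = -g z y) ∧ (∀ y z : EuclideanSpace ℝ (Fin 3), |g y z| ≤ G * (dist y z)⁻¹ ^ 6) ∧ (∀ y ∈ S, 2 * ((Literature.MathematicalPhysics.StatisticalMechanics.hcpPeriodicConfiguration ha hh).energyPerParticle Literature.MathematicalPhysics.StatisticalMechanics.lennardJones) ≤ (∑' z : ↥{z : EuclideanSpace ℝ (Fin 3) | z ∈ S ∧ z ≠ y}, Literature.MathematicalPhysics.StatisticalMechanics.lennardJones (dist y (z : EuclideanSpace ℝ (Fin 3)))) + (∑'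 z : ↥{z : EuclideanSpace ℝ (Fin 3) | z ∈ S ∧ z ≠ y}, g y (z : EuclideanSpace ℝ (Fin 3)))) ∧ (∀ y ∈ S, ¬ (let T : Set (EuclideanSpace ℝ (Fin 3)) := {z : EuclideanSpace ℝ (Fin 3) | z ∈ S ∧ z ≠ y ∧ dist z y < 13 / 10 * a}; let P : Set (EuclideanSpace ℝ (Fin 3)) := {p : EuclideanSpace ℝ (Fin 3) | p ∈ Literature.MathematicalPhysics.StatisticalMechanics.hcpStacking a h ∧ p ≠ 0 ∧ ‖p‖ < 13 / 10 * a}; ∃ A : EuclideanSpace ℝ (Fin 3) →ₗᵢ[ℝ] EuclideanSpace ℝ (Fin 3), ∃ e : ↥T ≃ ↥P, ∀ t : ↥T, dist ((t : EuclideanSpace ℝ (Fin 3)) - y) (A ((e t : ↥P) : EuclideanSpace ℝ (Fin 3))) ≤ η) → 2 * ((Literature.MathematicalPhysics.StatisticalMechanics.hcpPeriodicConfiguration ha hh).energyPerParticle Literature.MathematicalPhysics.StatisticalMechanics.lennardJones) + κ ≤ (∑' z : ↥{z : EuclideanSpace ℝ (Fin 3) | z ∈ S ∧ z ≠ y}, Literature.MathematicalPhysics.StatisticalMechanics.lennardJones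 (dist y (z : EuclideanSpace ℝ (Fin 3)))) + (∑' z : ↥{z : EuclideanSpace ℝ (Fin 3) | z ∈ S ∧ z ≠ y}, g y (z : EuclideanSpace ℝ (Fin 3))))) → ∀ (a h : ℝ) (ha : a ≠ 0) (hh : h ≠ 0), (9 / 10 < a ∧ a < 1 ∧ |h - a * Real.sqrt (2 / 3)| ≤ a / 100) → (∀ a' h' : ℝ, ∀ ha' : a' ≠ 0, ∀ hh' : h' ≠ 0, (9 / 10 < a' ∧ a' < 1 ∧ |h' - a' * Real.sqrt (2 / 3)| ≤ a' / 100) → (Literature.MathematicalPhysics.StatisticalMechanics.hcpPeriodicConfiguration ha hh).energyPerParticle Literature.MathematicalPhysics.StatisticalMechanics.lennardJones ≤ (Literature.MathematicalPhysics.StatisticalMechanics.hcpPeriodicConfiguration ha' hh').energyPerParticle Literature.MathematicalPhysics.StatisticalMechanics.lennardJones) → ∀ δ : ℝ, 0 < δ → ∀ η : ℝ, 0 < η → ∃ κ : ℝ, 0 < κ ∧ ∃ G : ℝ, 0 ≤ G ∧ ∀ S : Set (EuclideanSpace ℝ (Fin 3)), (∀ y ∈ S, ∀ z ∈ S, y ≠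 z → δ ≤ dist y z) → (∀ y ∈ S, (let d : ℝ := sInf ((fun z => dist z y) '' (S \ {y})); let T : Set (EuclideanSpace ℝ (Fin 3)) := {z : EuclideanSpace ℝ (Fin 3) | z ∈ S ∧ z ≠ y ∧ dist z y < 13 / 10 * d}; ∃ A : EuclideanSpace ℝ (Fin 3) →ₗᵢ[ℝ] EuclideanSpace ℝ (Fin 3), (∃ e : ↥T ≃ ↥Literature.Geometry.DiscreteGeometry.fccKissingPattern, ∀ t : ↥T, dist (d⁻¹ • ((t : EuclideanSpace ℝ (Fin 3)) - y)) (A ((e t : ↥Literature.Geometry.DiscreteGeometry.fccKissingPattern) : EuclideanSpace ℝ (Fin 3))) ≤ 1 / 20) ∨ (∃ e : ↥T ≃ ↥Literature.Geometry.DiscreteGeometry.hcpKissingPattern, ∀ t : ↥T, dist (d⁻¹ • ((t : EuclideanSpace ℝ (Fin 3)) - y)) (A ((e t : ↥Literature.Geometry.DiscreteGeometry.hcpKissingPattern) : EuclideanSpace ℝ (Fin 3))) ≤ 1 / 20))) → (∃ s : ℤ → ℤ, Literature.MathematicalPhysics.StatisticalMechanics.IsHaggSeq s ∧ ∃ Φ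 : EuclideanSpace ℝ (Fin 3) → EuclideanSpace ℝ (Fin 3), Set.BijOn Φ (Literature.MathematicalPhysics.StatisticalMechanics.barlowStacking 1 (Real.sqrt (2 / 3)) s) S ∧ ∀ p ∈ Literature.MathematicalPhysics.StatisticalMechanics.barlowStacking 1 (Real.sqrt (2 / 3)) s, ∃ A : EuclideanSpace ℝ (Fin 3) →ₗᵢ[ℝ] EuclideanSpace ℝ (Fin 3), ∃ l : ℝ, 0 < l ∧ ∀ q ∈ Literature.MathematicalPhysics.StatisticalMechanics.barlowStacking 1 (Real.sqrt (2 / 3)) s, dist q p ≤ 1 → dist (Φ q) (Φ p + l • A (q - p)) ≤ 1 / 20 * l) → ∃ g : EuclideanSpace ℝ (Fin 3) → EuclideanSpace ℝ (Fin 3) → ℝ, (∀ y z : EuclideanSpace ℝ (Fin 3), g y z = -g z y) ∧ (∀ y z : EuclideanSpace ℝ (Fin 3), |g y z| ≤ G * (dist y z)⁻¹ ^ 6) ∧ (∀ y ∈ S, 2 * ((Literature.MathematicalPhysics.StatisticalMechanics.hcpPeriodicConfiguration ha hh).energyPerParticle Literature.MathematicalPhysics.StatisticalMechanics.lennardJones)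 ≤ (∑' z : ↥{z : EuclideanSpace ℝ (Fin 3) | z ∈ S ∧ z ≠ y}, Literature.MathematicalPhysics.StatisticalMechanics.lennardJones (dist y (z : EuclideanSpace ℝ (Fin 3)))) + (∑' z : ↥{z : EuclideanSpace ℝ (Fin 3) | z ∈ S ∧ z ≠ y}, g y (z : EuclideanSpace ℝ (Fin 3)))) ∧ (∀ y ∈ S, ¬ (let T : Set (EuclideanSpace ℝ (Fin 3)) := {z : EuclideanSpace ℝ (Fin 3) | z ∈ S ∧ z ≠ y ∧ dist z y < 13 / 10 * a}; let P : Set (EuclideanSpace ℝ (Fin 3)) := {p : EuclideanSpace ℝ (Fin 3) | p ∈ Literature.MathematicalPhysics.StatisticalMechanics.hcpStacking a h ∧ p ≠ 0 ∧ ‖p‖ < 13 / 10 * a}; ∃ A : EuclideanSpace ℝ (Fin 3) →ₗᵢ[ℝ] EuclideanSpace ℝ (Fin 3), ∃ e : ↥T ≃ ↥P, ∀ t : ↥T, dist ((t : EuclideanSpace ℝ (Fin 3)) - y) (A ((e t : ↥P) : EuclideanSpace ℝ (Fin 3))) ≤ η) → 2 * ((Literature.MathematicalPhysics.StatisticalMechanics.hcpPeriodicConfiguration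 ha hh).energyPerParticle Literature.MathematicalPhysics.StatisticalMechanics.lennardJones) + κ ≤ (∑' z : ↥{z : EuclideanSpace ℝ (Fin 3) | z ∈ S ∧ z ≠ y}, Literature.MathematicalPhysics.StatisticalMechanics.lennardJones (dist y (z : EuclideanSpace ℝ (Fin 3)))) + (∑' z : ↥{z : EuclideanSpace ℝ (Fin 3) | z ∈ S ∧ z ≠ y}, g y (z : EuclideanSpace ℝ (Fin 3))))) →
    (∃ a h : ℝ, ∃ ha : a ≠ 0, ∃ hh : h ≠ 0, (9 / 10 < a ∧ a < 1 ∧ |h - a * Real.sqrt (2 / 3)| ≤ a / 100) ∧ (∀ δ : ℝ, 0 < δ → ∀ η : ℝ, 0 < η → ∃ κ : ℝ, 0 < κ ∧ ∃ C : ℝ, ∀ S : Set (EuclideanSpace ℝ (Fin 3)), (∀ y ∈ S, ∀ z ∈ S, y ≠ z → δ ≤ dist y z) → (∀ y ∈ S, (let d : ℝ := sInf ((fun z => dist z y) '' (S \ {y})); let T : Set (EuclideanSpace ℝ (Fin 3)) := {z : EuclideanSpace ℝ (Fin 3) | z ∈ S ∧ z ≠ y ∧ dist z y < 13 / 10 *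 d}; ∃ A : EuclideanSpace ℝ (Fin 3) →ₗᵢ[ℝ] EuclideanSpace ℝ (Fin 3), (∃ e : ↥T ≃ ↥Literature.Geometry.DiscreteGeometry.fccKissingPattern, ∀ t : ↥T, dist (d⁻¹ • ((t : EuclideanSpace ℝ (Fin 3)) - y)) (A ((e t : ↥Literature.Geometry.DiscreteGeometry.fccKissingPattern) : EuclideanSpace ℝ (Fin 3))) ≤ 1 / 20) ∨ (∃ e : ↥T ≃ ↥Literature.Geometry.DiscreteGeometry.hcpKissingPattern, ∀ t : ↥T, dist (d⁻¹ • ((t : EuclideanSpace ℝ (Fin 3)) - y)) (A ((e t : ↥Literature.Geometry.DiscreteGeometry.hcpKissingPattern) : EuclideanSpace ℝ (Fin 3))) ≤ 1 / 20))) → (∃ s : ℤ → ℤ, Literature.MathematicalPhysics.StatisticalMechanics.IsHaggSeq s ∧ ∃ Φ : EuclideanSpace ℝ (Fin 3) → EuclideanSpace ℝ (Fin 3), Set.BijOn Φ (Literature.MathematicalPhysics.StatisticalMechanics.barlowStacking 1 (Real.sqrt (2 / 3)) s) S ∧ ∀ p ∈ Literature.MathematicalPhysics.StatisticalMechanics.barlowStacking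 1 (Real.sqrt (2 / 3)) s, ∃ A : EuclideanSpace ℝ (Fin 3) →ₗᵢ[ℝ] EuclideanSpace ℝ (Fin 3), ∃ l : ℝ, 0 < l ∧ ∀ q ∈ Literature.MathematicalPhysics.StatisticalMechanics.barlowStacking 1 (Real.sqrt (2 / 3)) s, dist q p ≤ 1 → dist (Φ q) (Φ p + l • A (q - p)) ≤ 1 / 20 * l) → ∀ (c : EuclideanSpace ℝ (Fin 3)) (L : ℝ), 0 ≤ L → 2 * ((Literature.MathematicalPhysics.StatisticalMechanics.hcpPeriodicConfiguration ha hh).energyPerParticle Literature.MathematicalPhysics.StatisticalMechanics.lennardJones) * (({y : EuclideanSpace ℝ (Fin 3) | y ∈ S ∧ dist y c ≤ L} : Set (EuclideanSpace ℝ (Fin 3))).ncard : ℝ) + κ * (({y : EuclideanSpace ℝ (Fin 3) | y ∈ S ∧ dist y c ≤ L ∧ ¬ (let T : Set (EuclideanSpace ℝ (Fin 3)) := {z : EuclideanSpace ℝ (Fin 3) | z ∈ S ∧ z ≠ y ∧ dist z y < 13 / 10 * a}; let P : Set (EuclideanSpace ℝ (Fin 3)) := {p : EuclideanSpace ℝ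 (Fin 3) | p ∈ Literature.MathematicalPhysics.StatisticalMechanics.hcpStacking a h ∧ p ≠ 0 ∧ ‖p‖ < 13 / 10 * a}; ∃ A : EuclideanSpace ℝ (Fin 3) →ₗᵢ[ℝ] EuclideanSpace ℝ (Fin 3), ∃ e : ↥T ≃ ↥P, ∀ t : ↥T, dist ((t : EuclideanSpace ℝ (Fin 3)) - y) (A ((e t : ↥P) : EuclideanSpace ℝ (Fin 3))) ≤ η)} : Set (EuclideanSpace ℝ (Fin 3))).ncard : ℝ) - C * (L + 1) ^ 2 ≤ (∑' y : ↥{y : EuclideanSpace ℝ (Fin 3) | y ∈ S ∧ dist y c ≤ L}, (∑' z : ↥{z : EuclideanSpace ℝ (Fin 3) | z ∈ S ∧ z ≠ (y : EuclideanSpace ℝ (Fin 3))}, Literature.MathematicalPhysics.StatisticalMechanics.lennardJones (dist (y : EuclideanSpace ℝ (Fin 3)) (z : EuclideanSpace ℝ (Fin 3))))))) := by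
  intro hF hZ hZA
  have hA := hZA hZ
  obtain ⟨a, h, ha, hh, hbox, hmin⟩ :=
    Summit.AtomisticToContinuum.Crystallization.Theorems.HcpLandscapeGapBirth.stub_boxMinimiser
  refine ⟨a, h, ha, hh, hbox, ?_⟩
  intro δ hδ η hη
  obtain ⟨κ, hκ, G, hG, hAS⟩ := hA a h ha hh hbox hmin δ hδ η hη
  obtain ⟨C, hC⟩ := hF δ hδ G hG
  refine ⟨κ, hκ, C, ?_⟩
  intro S hsep hgood htempl c L hL
  obtain ⟨g, hanti, hbd, hfloor, hcoer⟩ := hAS S hsep hgood htempl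
  have hflux := hC S hsep g hanti hbd c L hL
  have key := window_sum_of_pointwise hδ hsep c L hfloor hcoer hflux
  exact key

/-- **The crux BY NAME from the three stubs** (the skeleton theorem of the audit: type literally the route
decl, no hypotheses; the only `sorry`s in its cone are `stub_fluxThroughBalls`, `stub_calibratedBarlowPricing`
and `stub_calibratedSiteInequality_of_barlow`). -/
theorem HcpLandscapeGap_of_stubs :
    Summit.AtomisticToContinuum.Crystallization.Theses.HullExactificationCascade.HcpLandscapeGap :=
  HcpLandscapeGap_of stub_fluxThroughBalls stub_calibratedBarlowPricing
    stub_calibratedSiteInequality_of_barlow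

end Summit.AtomisticToContinuum.Crystallization.Cruxes.HcpLandscapeGap.Calibration
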